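import Summits.Ventures.Crystal3D.Theorems.StickyWulffConstantCoaxialWallLawWordInstanceStateInv
import Summits.Ventures.Crystal3D.Theorems.StickyWulffConstantCoaxialWallLawTriadic
import Summits.Ventures.Crystal3D.Theorems.StickyWulffConstantCoaxialWallLawSources
import Summits.Ventures.Crystal3D.Theorems.StickyWulffConstantCoaxialWallLawBandCount
import Summits.Ventures.Crystal3D.Theorems.StickyWulffConstantCoaxialWallLawTwinFrames
import Summits.Ventures.Crystal3D.Theorems.StickyWulffConstantNoReconstructionGainSymmetry
import HarnessLib

/-!
# The NET count in the co-axial TRANSLATION cell with a 3-adically generic shift: payers ≥ (√2 α π ρ² − O((1+h)ρ))/2860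

HONEST FRAMING. Part of the venture `Summits/Ventures/Crystal3D` (cell `crystal3d-full`), helper for the
crux `CoaxialWallLaw` (stmt-Ventures-19481) of `route-Ventures-StickyWulffConstant`, REGISTERED line
`WallLedgerF` (planner cf-p1 gen 16), open stub `stub_coaxialTwoSlabAdhesion` (general fillings).  Sibling of
`wordNet_twin_payers_ge_inPlane` (`…InPlaneCell`) for TRANSLATION pairs: both grains carry the SAME frame `G₀`
(`P₁ ⊆ G₀·Λ₀ + s₁`, `P₂ ⊆ G₀·Λ₀ + s₂`), and the band is emptied not by rigidity but by the 3-ADIC POSITION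
INVARIANT (`…Triadic`): every ball reached by 19481-p2's word automaton rooted at the bottom frame lies in
`s₁ + G₀(3^{-k}Λ₀)` for some `k`, so if the shift is 3-adically generic — `3^k (s₂ − s₁) ∉ G₀·Λ₀` for every `k` —
no reachable state ever sits on a ball of the sealed top sample (`word_sources_le_lists_stateInv`).  Rung credit only;
F-C1 not moved.

**Theorem (`wordNet_trans_payers_ge_generic`).**  Frame `G₀`, root slot `u` with rise `α = (G₀ u)₂ > 0`, two-slab cell
(`X` `1`-separated, `10 ≤ R₀ ≤ ρ`, complete samples), generic shift, `KissingGap δ` / `KissingClassification δ` by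
name: `√2 α π ρ² − (12√2π + 36R₀ + 55440) ρ ≤ 2860 · #{z ∈ X : deg z ≤ 11, −R₀ − 2 ≤ z₂ ≤ h + R₀ + 2}` — no band,
no residual, no condition on the inclination.

WHAT THIS IS NOT: not the stub (next file: deficiency/stub shape); shifts in `s₁ + G₀(ℤ[1/3]Λ₀)` (the coherent
stacking-fault cosets and their 3-adic refinements) are NOT covered; F-C1 not moved.
-/
noncomputable section

namespace Summit.Ventures.Crystal3D.Theorems

open Summit.Ventures.Crystal3D Finset
open Literature.MathematicalPhysics.StatisticalMechanics (fccStacking)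
open scoped InnerProductSpace

open scoped Classical in
/-- **The NET count feeds the payers (co-axial translation cell, generic shift; no band, no residual).**  See the
module docstring. -/
theorem wordNet_trans_payers_ge_generic {δ : ℝ} (hg : KissingGap δ) (hc : KissingClassification δ)
    (G₀ : EuclideanSpace ℝ (Fin 3) ≃ₗᵢ[ℝ] EuclideanSpace ℝ (Fin 3))
    {ustar : EuclideanSpace ℝ (Fin 3)} (hustar : ustar ∈ fccSlots)
    (hα₁ : 0 < (G₀ ustar) 2)
    (s₁ s₂ : EuclideanSpace ℝ (Fin 3)) (X P₁ P₂ : Finset (EuclideanSpace ℝ (Fin 3))) (R₀ h ρ : ℝ)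
    (hR₀ : 10 ≤ R₀) (hh : 0 ≤ h) (hρ : R₀ ≤ ρ)
    (hX : ∀ p ∈ X, ∀ q ∈ X, p ≠ q → 1 ≤ dist p q)
    (hcell : ∀ p ∈ X, -(2 * R₀) ≤ p 2 ∧ p 2 ≤ h + 2 * R₀ ∧ p 0 ^ 2 + p 1 ^ 2 ≤ ρ ^ 2)
    (hP₁X : P₁ ⊆ X) (hP₂X : P₂ ⊆ X)
    (hP₁ : ∀ p, p ∈ P₁ ↔ (p ∈ (fun q => G₀ q + s₁) '' fccStacking 1 (Real.sqrt (2 / 3)) ∧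
      -(2 * R₀) ≤ p 2 ∧ p 2 ≤ -R₀ ∧ p 0 ^ 2 + p 1 ^ 2 ≤ ρ ^ 2))
    (hP₂ : ∀ p, p ∈ P₂ ↔ (p ∈ (fun q => G₀ q + s₂) '' fccStacking 1 (Real.sqrt (2 / 3)) ∧
      h + R₀ ≤ p 2 ∧ p 2 ≤ h + 2 * R₀ ∧ p 0 ^ 2 + p 1 ^ 2 ≤ ρ ^ 2))
    (hgen : ∀ k : ℕ, ∀ q ∈ fccStacking 1 (Real.sqrt (2 / 3)), ((3 : ℝ) ^ k) • (s₂ - s₁) ≠ G₀ q) :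
    Real.sqrt 2 * (G₀ ustar) 2 * Real.pi * ρ ^ 2 - (12 * Real.sqrt 2 * Real.pi + 36 * R₀ + 55440) * ρ ≤
      2860 * ((X.filter fun z => (X.filter fun q => dist z q = 1).card ≤ 11 ∧
          -R₀ - 2 ≤ z 2 ∧ z 2 ≤ h + R₀ + 2).card : ℝ) := by
  have hr : 0 < Real.sqrt (2 / 3) := Real.sqrt_pos.2 (by norm_num)
  have hR₀3 : (3 : ℝ) ≤ R₀ := by linarith
  have hρ0 : (0 : ℝ) ≤ ρ := by linarith
  have hρ1 : (1 : ℝ) ≤ ρ := by linarith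
  -- the word data over the bottom frame
  set Fw : List (EuclideanSpace ℝ (Fin 3)) → (EuclideanSpace ℝ (Fin 3) ≃ₗᵢ[ℝ] EuclideanSpace ℝ (Fin 3)) :=
    fun κ => κ.foldr (fun μ G => ((ℝ ∙ μ)ᗮ.reflection).trans G) G₀ with hFw
  set uw : List (EuclideanSpace ℝ (Fin 3)) → EuclideanSpace ℝ (Fin 3) := fun κ => κ.foldr (fun _ v => -v) ustar
    with huw
  set WFw : List (EuclideanSpace ℝ (Fin 3)) → Prop := fun κ =>
    List.rec (motive := fun _ => Prop) True (fun μ κ' ih => ih ∧ ‖μ‖ = 1 ∧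
      (∀ w ∈ fccSlots, ⟪w, μ⟫_ℝ = 0 ∨ ⟪w, μ⟫_ℝ = Real.sqrt (2 / 3) ∨ ⟪w, μ⟫_ℝ = -Real.sqrt (2 / 3)) ∧
      ⟪uw κ', μ⟫_ℝ = Real.sqrt (2 / 3) ∧ ∀ μ' κ'', κ' = μ' :: κ'' → μ' ≠ -μ) κ with hWFw
  set nextw : List (EuclideanSpace ℝ (Fin 3)) → EuclideanSpace ℝ (Fin 3) → List (EuclideanSpace ℝ (Fin 3)) :=
    fun κ m => @ite _ (∃ μ κ', κ = μ :: κ' ∧ (Fw κ).symm m = -μ) (Classical.propDecidable _) κ.tail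
      ((Fw κ).symm m :: κ) with hnextw
  have hF0 : Fw [] = G₀ := rfl
  have hFc : ∀ μ κ, Fw (μ :: κ) = ((ℝ ∙ μ)ᗮ.reflection).trans (Fw κ) := fun _ _ => rfl
  have hu0 : uw [] = ustar := rfl
  have huc : ∀ μ κ, uw (μ :: κ) = -uw κ := fun _ _ => rfl
  have hWF0 : WFw [] := trivial
  have hWFc : ∀ μ κ, WFw (μ :: κ) ↔ (WFw κ ∧ ‖μ‖ = 1 ∧
      (∀ w ∈ fccSlots, ⟪w, μ⟫_ℝ = 0 ∨ ⟪w, μ⟫_ℝ = Real.sqrt (2 / 3) ∨ ⟪w, μ⟫_ℝ = -Real.sqrt (2 / 3)) ∧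
      ⟪uw κ, μ⟫_ℝ = Real.sqrt (2 / 3) ∧ ∀ μ' κ', κ = μ' :: κ' → μ' ≠ -μ) := fun _ _ => Iff.rfl
  have hnext_pop : ∀ μ κ' (m : EuclideanSpace ℝ (Fin 3)), (Fw (μ :: κ')).symm m = -μ → nextw (μ :: κ') m = κ' := by
    intro μ κ' m hν
    simp only [hnextw]
    rw [if_pos ⟨μ, κ', rfl, hν⟩, List.tail_cons]
  have hnext_push : ∀ κ (m : EuclideanSpace ℝ (Fin 3)), (∀ μ κ', κ = μ :: κ' → (Fw κ).symm m ≠ -μ) →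
      nextw κ m = (Fw κ).symm m :: κ := by
    intro κ m hnp
    simp only [hnextw]
    rw [if_neg]
    rintro ⟨μ, κ', h, hν⟩
    exact hnp μ κ' h hν
  clear_value nextw WFw uw Fw
  have hu : ∀ κ, uw κ ∈ fccSlots := word_u_mem hustar hu0 huc
  -- the 3-adic position invariant
  set Pst : EuclideanSpace ℝ (Fin 3) × List (EuclideanSpace ℝ (Fin 3)) → Prop := fun v =>
    ∃ k : ℕ, ∃ q ∈ fccStacking 1 (Real.sqrt (2 / 3)), ((3 : ℝ) ^ k) • (v.1 - s₁) = G₀ q with hPst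
  have hpow : ∀ (k : ℕ) {x : EuclideanSpace ℝ (Fin 3)}, x ∈ fccStacking 1 (Real.sqrt (2 / 3)) →
      ((3 : ℝ) ^ k) • x ∈ fccStacking 1 (Real.sqrt (2 / 3)) := by
    intro k x hx
    have := fcc_zsmul_mem (3 ^ k) hx
    push_cast at this
    exact this
  have hstep : ∀ (b : EuclideanSpace ℝ (Fin 3)) (κ : List (EuclideanSpace ℝ (Fin 3))), WFw κ →
      Pst (b, κ) → ∀ κ', WFw κ' → Pst (b + Fw κ' (uw κ'), κ') := by
    intro b κ _ hP κ' hκ'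
    obtain ⟨k, q, hq, hkq⟩ := hP
    obtain ⟨q', hq', hd⟩ := word_dir_triadic hFc hu huc hWFc hκ'
    rw [hF0] at hd
    refine ⟨k + κ'.length, ((3 : ℝ) ^ κ'.length) • q + ((3 : ℝ) ^ k) • q',
      fcc_add_site_mem (hpow _ hq) (hpow _ hq'), ?_⟩
    have e : ((3 : ℝ) ^ (k + κ'.length)) • (b + Fw κ' (uw κ') - s₁) =
        ((3 : ℝ) ^ κ'.length) • (((3 : ℝ) ^ k) • (b - s₁)) + ((3 : ℝ) ^ k) • (((3 : ℝ) ^ κ'.length) • Fw κ' (uw κ')) := by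
      rw [smul_smul, smul_smul, pow_add]; module
    have hkq' : ((3 : ℝ) ^ k) • (b - s₁) = G₀ q := hkq
    rw [e, hkq', hd, map_add, LinearIsometryEquiv.map_smul, LinearIsometryEquiv.map_smul]
  have hPfull : ∀ (b : EuclideanSpace ℝ (Fin 3)) (κ : List (EuclideanSpace ℝ (Fin 3))), WFw κ →
      Pst (b, κ) → Pst (b + Fw κ (uw κ), κ) := fun b κ hκ hP => hstep b κ hκ hP κ hκ
  have hPcross : ∀ (b : EuclideanSpace ℝ (Fin 3)) (κ : List (EuclideanSpace ℝ (Fin 3))) (m : EuclideanSpace ℝ (Fin 3)),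
      WFw κ → WFw (nextw κ m) → Pst (b, κ) → Pst (b + Fw (nextw κ m) (uw (nextw κ m)), nextw κ m) :=
    fun b κ m hκ hκ' hP => hstep b κ hκ hP _ hκ'
  have hPtop : ∀ (b : EuclideanSpace ℝ (Fin 3)) (κ : List (EuclideanSpace ℝ (Fin 3))), WFw κ → Pst (b, κ) → b ∉ P₂ := by
    intro b κ _ hP hb
    obtain ⟨k, q, hq, hkq⟩ := hP
    obtain ⟨⟨q₂, hq₂, hb₂⟩, -, -, -⟩ := (hP₂ b).1 hb
    have hmem : q - ((3 : ℝ) ^ k) • q₂ ∈ fccStacking 1 (Real.sqrt (2 / 3)) := by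
      rw [sub_eq_add_neg]; exact fcc_add_site_mem hq (fcc_neg_mem (hpow k hq₂))
    apply hgen k _ hmem
    have hkq' : ((3 : ℝ) ^ k) • (b - s₁) = G₀ q := hkq
    have e : s₂ - s₁ = (b - s₁) - (b - s₂) := by abel
    have hb' : b - s₂ = G₀ q₂ := by rw [← hb₂]; simp
    rw [e, smul_sub, hkq', hb', map_sub, LinearIsometryEquiv.map_smul]
  -- the inner sample
  set zcut : ℝ := h + R₀ + 1 with hzcut
  set P' : Finset (EuclideanSpace ℝ (Fin 3)) := P₁.filter fun p =>
    -(2 * R₀) + 1 ≤ p 2 ∧ p 2 ≤ -R₀ - 1 ∧ p 0 ^ 2 + p 1 ^ 2 ≤ (ρ - 1) ^ 2 with hP'def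
  have hP'iff : ∀ p, p ∈ P' ↔ (p ∈ (fun q => G₀ q + s₁) '' fccStacking 1 (Real.sqrt (2 / 3)) ∧
      -(2 * R₀) + 1 ≤ p 2 ∧ p 2 ≤ -R₀ - 1 ∧ p 0 ^ 2 + p 1 ^ 2 ≤ (ρ - 1) ^ 2) := by
    intro p
    rw [hP'def, mem_filter, hP₁]
    constructor
    · rintro ⟨⟨hΛ, -, -, -⟩, h1, h2, h3⟩; exact ⟨hΛ, h1, h2, h3⟩
    · rintro ⟨hΛ, h1, h2, h3⟩
      have hρ1' : (0 : ℝ) ≤ ρ - 1 := by linarith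
      exact ⟨⟨hΛ, by linarith, by linarith, by nlinarith⟩, h1, h2, h3⟩
  -- the inner sample has full shells (complete sample)
  have hP'full : ∀ p ∈ P', ∀ w ∈ fccSlots, p + Fw [] w ∈ X := by
    intro p hp w hw
    rw [hF0]
    obtain ⟨hΛ, h1, h2, h3⟩ := (hP'iff p).1 hp
    apply hP₁X
    rw [hP₁]
    have hw2 : |(G₀ w) 2| ≤ 1 := by rw [apply_two_eq_inner_e₃]; exact abs_inner_slot_le_one G₀ hw
    obtain ⟨hw2a, hw2b⟩ := abs_le.1 hw2
    refine ⟨movedFcc_add_site_mem G₀ s₁ hΛ (mem_fcc_of_mem_fccSlots hw), ?_, ?_, ?_⟩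
    · show -(2 * R₀) ≤ (p + G₀ w) 2
      rw [PiLp.add_apply]; linarith
    · show (p + G₀ w) 2 ≤ -R₀
      rw [PiLp.add_apply]; linarith
    · show (p + G₀ w) 0 ^ 2 + (p + G₀ w) 1 ^ 2 ≤ ρ ^ 2
      have hρ1' : (0 : ℝ) ≤ ρ - 1 := by linarith
      have hsl : Real.sqrt (p 0 ^ 2 + p 1 ^ 2) ≤ ρ - 1 := by
        rw [← Real.sqrt_sq hρ1']; exact Real.sqrt_le_sqrt h3
      have e1 := sqrt_lateral_add_le p (G₀ w)
      rw [LinearIsometryEquiv.norm_map, norm_eq_one_of_mem_fccSlots hw] at e1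
      have e3 : Real.sqrt ((p + G₀ w) 0 ^ 2 + (p + G₀ w) 1 ^ 2) ≤ ρ := by linarith
      have e4 := Real.sq_sqrt (by positivity : (0 : ℝ) ≤ (p + G₀ w) 0 ^ 2 + (p + G₀ w) 1 ^ 2)
      have e5 : (0 : ℝ) ≤ Real.sqrt ((p + G₀ w) 0 ^ 2 + (p + G₀ w) 1 ^ 2) := Real.sqrt_nonneg _
      nlinarith
  -- (1) the NET count of the word automaton
  have hup : 0 < (Fw [] (uw [])) 2 := by rw [hF0, hu0]; exact hα₁
  have hP₁' : ∀ p, p ∈ P₁ ↔ (p ∈ (fun q => Fw [] q + s₁) '' fccStacking 1 (Real.sqrt (2 / 3)) ∧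
      -(2 * R₀) ≤ p 2 ∧ p 2 ≤ -R₀ ∧ p 0 ^ 2 + p 1 ^ 2 ≤ ρ ^ 2) := by rw [hF0]; exact hP₁
  have hP'iff' : ∀ p, p ∈ P' ↔ (p ∈ (fun q => Fw [] q + s₁) '' fccStacking 1 (Real.sqrt (2 / 3)) ∧
      -(2 * R₀) + 1 ≤ p 2 ∧ p 2 ≤ -R₀ - 1 ∧ p 0 ^ 2 + p 1 ^ 2 ≤ (ρ - 1) ^ 2) := by rw [hF0]; exact hP'iff
  have hPsrc : ∀ p ∈ P', Pst (p + Fw [] (uw []), []) := by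
    intro p hp
    obtain ⟨⟨q₀, hq₀, hp₀⟩, -, -, -⟩ := (hP'iff p).1 hp
    refine ⟨0, q₀ + ustar, fcc_add_site_mem hq₀ (mem_fcc_of_mem_fccSlots hustar), ?_⟩
    show ((3 : ℝ) ^ 0) • (p + Fw [] (uw []) - s₁) = G₀ (q₀ + ustar)
    rw [pow_zero, one_smul, hF0, hu0, ← hp₀, map_add]
    simp only
    abel
  have hcore := word_sources_le_lists_stateInv (F := Fw) (u := uw) (WF := WFw) (next := nextw) (t₁ := s₁) (t₂ := s₂)
    hg hc hX hFc hu huc hWF0 hWFc hnext_pop hnext_push G₀ hPfull hPcross hPtop hup hR₀3 hρ hcell hP₁X hP₂X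
    hP₁' hP'iff' hP'full hPsrc hP₂
  rw [hF0, hu0] at hcore
  -- (2) the sources
  have hsources := card_vertical_tops_ge G₀ s₁ X P₁ P' R₀ ρ zcut hR₀3 hρ (by rw [hzcut]; linarith)
    hX hP₁X hP₁ hP'iff hustar (by rw [← apply_two_eq_inner_e₃]; exact hα₁.le)
  -- (3) the rims
  set RIMT := X.filter fun s => zcut ≤ s 2 ∧ s 2 ≤ zcut + 1 ∧ (ρ - 2) ^ 2 < s 0 ^ 2 + s 1 ^ 2 with hRIMT
  have hrimT : (RIMT.card : ℝ) ≤ 144 * ρ := by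
    have hsep : ∀ p ∈ RIMT, ∀ q ∈ RIMT, p ≠ q → 1 ≤ dist p q :=
      fun p hp q hq hpq => hX p (mem_filter.1 hp).1 q (mem_filter.1 hq).1 hpq
    have hmem : ∀ p ∈ RIMT, zcut ≤ p 2 ∧ p 2 ≤ zcut + 1 ∧ (ρ - 2) ^ 2 < p 0 ^ 2 + p 1 ^ 2 ∧
        p 0 ^ 2 + p 1 ^ 2 ≤ ρ ^ 2 := by
      intro p hp
      obtain ⟨hpX, h1, h2, h3⟩ := mem_filter.1 hp
      exact ⟨h1, h2, h3, (hcell p hpX).2.2⟩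
    have key := card_mul_le_of_separated_in_shell RIMT hsep zcut (zcut + 1) (ρ - 2) ρ (by linarith)
      (by linarith) (by linarith) hmem
    have e : (zcut + 1 - zcut + 2) * (Real.pi * (ρ + 1) ^ 2 - Real.pi * (ρ - 2 - 1) ^ 2) =
        (Real.pi / 6) * (144 * ρ - 144) := by ring
    rw [e] at key
    have hπ : 0 < Real.pi / 6 := by positivity
    have := le_of_mul_le_mul_right (by linarith [key] : (RIMT.card : ℝ) * (Real.pi / 6) ≤
      (144 * ρ - 144) * (Real.pi / 6)) hπ
    linarith
  set RIMB := X.filter fun s => -R₀ - 1 - 1 ≤ s 2 ∧ s 2 < -R₀ - 1 ∧ (ρ - 1) ^ 2 < s 0 ^ 2 + s 1 ^ 2 with hRIMB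
  have hrimB : (RIMB.card : ℝ) ≤ 108 * ρ := by
    have hsep : ∀ p ∈ RIMB, ∀ q ∈ RIMB, p ≠ q → 1 ≤ dist p q :=
      fun p hp q hq hpq => hX p (mem_filter.1 hp).1 q (mem_filter.1 hq).1 hpq
    have hmem : ∀ p ∈ RIMB, -R₀ - 1 - 1 ≤ p 2 ∧ p 2 ≤ -R₀ - 1 ∧ (ρ - 1) ^ 2 < p 0 ^ 2 + p 1 ^ 2 ∧
        p 0 ^ 2 + p 1 ^ 2 ≤ ρ ^ 2 := by
      intro p hp
      obtain ⟨hpX, h1, h2, h3⟩ := mem_filter.1 hp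
      exact ⟨h1, h2.le, h3, (hcell p hpX).2.2⟩
    have key := card_mul_le_of_separated_in_shell RIMB hsep (-R₀ - 1 - 1) (-R₀ - 1) (ρ - 1) ρ (by linarith)
      (by linarith) (by linarith) hmem
    have e : (-R₀ - 1 - (-R₀ - 1 - 1) + 2) * (Real.pi * (ρ + 1) ^ 2 - Real.pi * (ρ - 1 - 1) ^ 2) =
        (Real.pi / 6) * (108 * ρ - 54) := by ring
    rw [e] at key
    have hπ : 0 < Real.pi / 6 := by positivity
    have := le_of_mul_le_mul_right (by linarith [key] : (RIMB.card : ℝ) * (Real.pi / 6) ≤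
      (108 * ρ - 54) * (Real.pi / 6)) hπ
    linarith
  -- (4) arithmetic
  set α₁ := (G₀ ustar) 2 with hα₁def
  set PAY := X.filter fun z => (X.filter fun q => dist z q = 1).card ≤ 11 ∧ -R₀ - 2 ≤ z 2 ∧ z 2 ≤ h + R₀ + 2
    with hPAY
  have hα₁' : ⟪G₀ ustar, EuclideanSpace.single (2 : Fin 3) (1 : ℝ)⟫_ℝ = α₁ := (apply_two_eq_inner_e₃ _).symm
  have hα₁le : α₁ ≤ 1 := by
    rw [← hα₁']; exact (abs_le.1 (abs_inner_slot_le_one G₀ hustar)).2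
  rw [hα₁', abs_of_pos hα₁] at hsources
  -- identify the payer window of the core with `PAY`
  have hPAYeq : (X.filter fun z => (X.filter fun q => dist z q = 1).card ≤ 11 ∧
      -R₀ - 1 - 1 ≤ z 2 ∧ z 2 ≤ h + R₀ + 1 + 1) = PAY := by
    refine filter_congr fun z _ => ?_
    rw [show -R₀ - 1 - 1 = -R₀ - 2 by ring, show h + R₀ + 1 + 1 = h + R₀ + 2 by ring]
  rw [hPAYeq] at hcore
  -- the core count, cast to `ℝ`
  have hcast : ((P'.filter fun p => (∀ w ∈ fccSlots, p + G₀ w ∈ X) ∧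
      -R₀ - 1 < (p + G₀ ustar) 2 ∧ (p + G₀ ustar) 2 < zcut).card : ℝ) ≤
      13 * 220 * (PAY.card : ℝ) + 220 * (RIMT.card : ℝ) + 220 * (RIMB.card : ℝ) := by
    have h0 : (P'.filter fun p => (∀ w ∈ fccSlots, p + G₀ w ∈ X) ∧
        -R₀ - 1 < (p + G₀ ustar) 2 ∧ (p + G₀ ustar) 2 < zcut).card ≤
        13 * 220 * PAY.card + 220 * RIMT.card + 220 * RIMB.card := hcore
    exact_mod_cast h0
  have hsrc' : Real.sqrt 2 * α₁ * Real.pi * (ρ - 1) ^ 2 - 10 * Real.sqrt 2 * Real.pi * (ρ - 1) - 36 * R₀ * ρ ≤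
      ((P'.filter fun p => (∀ w ∈ fccSlots, p + G₀ w ∈ X) ∧
        -R₀ - 1 < (p + G₀ ustar) 2 ∧ (p + G₀ ustar) 2 < zcut).card : ℝ) := by
    convert hsources using 4
  have h2 : 0 ≤ Real.sqrt 2 := Real.sqrt_nonneg _
  have hπ : 0 ≤ Real.pi := Real.pi_pos.le
  have hsq : Real.sqrt 2 * α₁ * Real.pi * (ρ - 1) ^ 2 ≥ Real.sqrt 2 * α₁ * Real.pi * ρ ^ 2 - 2 * Real.sqrt 2 * Real.pi * ρ := by
    have hα₁0 : 0 ≤ α₁ := hα₁.le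
    have : Real.sqrt 2 * α₁ * Real.pi * (ρ - 1) ^ 2 = Real.sqrt 2 * α₁ * Real.pi * ρ ^ 2 -
        2 * Real.sqrt 2 * α₁ * Real.pi * ρ + Real.sqrt 2 * α₁ * Real.pi := by ring
    rw [this]
    have h1 : Real.sqrt 2 * α₁ * Real.pi * ρ ≤ Real.sqrt 2 * Real.pi * ρ := by
      have := mul_le_mul_of_nonneg_left hα₁le (by positivity : 0 ≤ Real.sqrt 2 * Real.pi * ρ)
      have e1 : Real.sqrt 2 * α₁ * Real.pi * ρ = Real.sqrt 2 * Real.pi * ρ * α₁ := by ring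
      rw [mul_one] at this; rw [e1]; exact this
    have h3 : 0 ≤ Real.sqrt 2 * α₁ * Real.pi := mul_nonneg (mul_nonneg h2 hα₁0) hπ
    linarith
  have h2π : 0 ≤ Real.sqrt 2 * Real.pi * ρ := mul_nonneg (mul_nonneg h2 hπ) hρ0
  have h10 : 10 * Real.sqrt 2 * Real.pi * (ρ - 1) ≤ 10 * Real.sqrt 2 * Real.pi * ρ := by nlinarith only [h2π, h2, hπ]
  linarith only [hcast, hsrc', hrimT, hrimB, hsq, h10, h2π]

end Summit.Ventures.Crystal3D.Theorems

end
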